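import Summits.QuantumFields.YangMills.Theorems.ToronSmallBallOffCoreStripWindowDeepGlue
import Summits.QuantumFields.YangMills.Theorems.ToronSmallBallPeriodicOffCoreStripWindowDeep
import Summits.QuantumFields.YangMills.Theorems.FluxSectorLaplaceFluxSectorSuppression
import HarnessLib

/-!
# `ToronSmallBall.OffCoreStripWindowDeep` composed from its proved halves, and the aside `OffCoreStripWindow` (item stmt-QuantumFields-23899)

Route `ToronSmallBall` (LINE g12-A of ideator seat ym-idea-4).  The crux `OffCoreStripWindowDeep` ⟨23957⟩ was closed BY SPLIT: its halves
`FluxSectorSuppression` ⟨24079⟩ (`FluxSectorLaplace.fluxSectorSuppression_proof`, flux reflection, seat g17) and `PeriodicOffCoreStripWindowDeep`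
⟨24089⟩ (`periodicOffCoreStripWindowDeep_proof`) are kernel-checked, and the glue `offCoreStripWindowDeep_of_sectors` ⟨24090⟩ composes them; we record
the composed theorem ★ `offCoreStripWindowDeep_proof`.  The aside ★ `OffCoreStripWindow` ⟨23899⟩ (cap `3/10`) is the same statement with a smaller
cap than `OffCoreStripWindowDeep` (cap `2/5`), hence follows at once (`offCoreStripWindow_proof`, BY NAME).

HONEST FRAMING: fixed-lattice transfer-matrix estimates on a femto window; nothing about infinite volume, the continuum limit or the Clay Yang–Mills gap —
the YM mass gap is NOT proved.  No `sorry`, no new axiom, no new definition.  References: [cite: Luscher1983, §2]; [cite: tHooft1979];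
[cite: MontvayMunster1994, (3.145)].
-/

set_option autoImplicit false

namespace Summit.QuantumFields.YangMills.Theorems.ToronSmallBall

/-- ★ **`ToronSmallBall.OffCoreStripWindowDeep` holds** (item ⟨23957⟩, closed by split; composed from its two proved halves by the glue ⟨24090⟩).
[cite: tHooft1979] [cite: MontvayMunster1994, (3.145)] -/
theorem offCoreStripWindowDeep_proof : Summit.QuantumFields.YangMills.Theses.ToronSmallBall.OffCoreStripWindowDeep :=
  offCoreStripWindowDeep_of_sectors FluxSectorLaplace.fluxSectorSuppression_proof periodicOffCoreStripWindowDeep_proof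

/-- ★ **The aside `ToronSmallBall.OffCoreStripWindow` holds** (item stmt-QuantumFields-23899, BY NAME): cap `3/10 ≤ 2/5`.  The YM mass gap is NOT
proved. [cite: Luscher1983, §2] -/
theorem offCoreStripWindow_proof : Summit.QuantumFields.YangMills.Theses.ToronSmallBall.OffCoreStripWindow :=
  fun γc hγc => offCoreStripWindowDeep_proof γc (le_trans hγc (by norm_num))

end Summit.QuantumFields.YangMills.Theorems.ToronSmallBall
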